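/-
Origin: expansion seat `planner-pub-hodgecm-toy-g3-0`, handover #7 2026-08-18T12:10:34Z (`HOME/pub-hodgecm-toy-g3/lean/ToyG3/TrTopAll3.lean`, md5 4950e6a3, 92 lines);
landed by the gen-8 packager in gate run 29 as `HodgeCM/Model/ToyG2/TrTopAll3.lean` (import ^import ToyG3\.TrTop3[ \t]*$→import HodgeCM.Model.ToyG2.TrTop3 ×1).
-/
/-
Copyright: pub-hodgecm formalisation cell (harness21, 2026). New file (not vendored).
Origin: session planner-pub-hodgecm-toy-g3-0 (unit pub-hodgecm-toy-g3, EXPANSION part (e) CONSISTENCY WITNESS, gen 3 of the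
lineage toy → toy-g2 → toy-g3), 2026-08-18.  WIP module `ToyG3.TrTopAll3`; intended final place
`HodgeCM/Model/ToyG2/TrTopAll3.lean` (module `HodgeCM.Model.ToyG2.TrTopAll3`; kind L5, toy model / consistency witness —
ONE NEW ADDITIVE FILE, no landed file is touched).  WIP imports: `ToyG3.TrTop3` ↦ `HodgeCM.Model.ToyG2.TrTop3` (this seat) and
`HodgeCM.Model.ToyG2.SplitAllGood` is pv03-g6's, in the tree since gate run 28 (imported by its FINAL name).
-/
import Mathlib
import Summits.HodgeConjecture.HodgeCM.Model.ToyG2.TrTop3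
import Summits.HodgeConjecture.HodgeCM.Model.ToyG2.SplitAllGood
import Summits.HodgeConjecture.HodgeCM.Model.Toy.Toy
import Summits.HodgeConjecture.HodgeCM.Model.Toy.ToyTrTop

/-!
# T-CM in `toyUniverse₃ d t`, unconditionally

`TrTop3` proves T-CM `Fact_trTopCM` for `toyUniverse₃ d t` from its model axioms; pv03-g6's
`HodgeCM.ToyG2.toyUniverse₃_modelAxioms_all d t` (`Model/ToyG2/SplitAllGood.lean`, gate run 28) supplies them for every
`d t`.  Hence the hypothesis-free forms below, and the existence statements over `toyUniverse₃ 1 4`: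

* `exists_descentFactsB₄_inputs_and_trTopCM` — ONE universe satisfying the ten binders of `Assembly.COR_CM_of_descentFactsB₄`
  AND T-CM (eleven facts, realisation included);
* `exists_genericFacts_but_gysin` — ONE universe satisfying ten of the eleven binders of `Assembly.COR_CM_of_genericFacts`
  (all but F7 `Fact_gysin`);
* `exists_models_separating_trTopCM`, `trTopCM_independent` — T-CM is independent of `ModelAxioms`.

So `Fact_trTopCM` — "REFUTED in the exterior model and in every re-trace" (FACTS.md §1c, generation 1) — is CONSISTENT with
the model axioms, the face realisation and every generic [QW8] input witnessed so far; together with generation 1's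
`HodgeCM.Toy.not_fact_trTopCM` (`Model/Toy/ToyTrTop.lean`: false in `toyModel`, which has all 28 model axioms,
`HodgeCM.Toy.toyModel_modelAxioms`) it is INDEPENDENT of `ModelAxioms`: `exists_models_separating_trTopCM`, `trTopCM_independent`
(the right word for FACTS.md is "not derivable; independent", not "refuted" — remark of the qw8b-g6 seat, 2026-08-18T12:06Z).
Nothing is said about complex projective varieties; kernel-proved from the tree, no citation, nothing posited; default heartbeats.
-/

noncomputable section

namespace HodgeCM.ToyG2

open HodgeCM.Toy Literature.AlgebraicGeometry.Motives

variable (d t : ℚ)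

/-- **T-CM `Fact_trTopCM` holds in `toyUniverse₃ d t`**, for every `d t`. -/
theorem toyUniverse₃_trTopCM_all : (toyUniverse₃ d t).Fact_trTopCM :=
  toyUniverse₃_trTopCM d t (toyUniverse₃_modelAxioms_all d t)

/-- the ten binders of `COR_CM_of_descentFactsB₄` and T-CM, jointly, in `toyUniverse₃ d t` (`1 ≤ d`, `t² = 16`) -/
theorem toyUniverse₃_descentFactsB₄_and_trTopCM_all (hd : 1 ≤ d) (ht : t ^ 2 = 16) :
    ((toyUniverse₃ d t).ModelAxioms ∧ (toyUniverse₃ d t).RealisationExistsFace ∧ (toyUniverse₃ d t).Fact_cupExterior ∧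
      (toyUniverse₃ d t).Fact_cup_hodge ∧ (toyUniverse₃ d t).Fact_cupAlg ∧ (toyUniverse₃ d t).Fact_cupAssoc ∧
      (toyUniverse₃ d t).Fact_unitH0 ∧ (toyUniverse₃ d t).Fact_gysinDescentB ∧ (toyUniverse₃ d t).Fact_dimProd) ∧
    (toyUniverse₃ d t).Fact_trTopCM :=
  toyUniverse₃_descentFactsB₄_and_trTopCM d t hd ht (toyUniverse₃_modelAxioms_all d t)

/-- ten of the eleven binders of `COR_CM_of_genericFacts` (all but F7), jointly, in `toyUniverse₃ d t` (`1 ≤ d`, `t² = 16`) -/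
theorem toyUniverse₃_genericFacts_but_gysin_all (hd : 1 ≤ d) (ht : t ^ 2 = 16) :
    (toyUniverse₃ d t).ModelAxioms ∧ (toyUniverse₃ d t).RealisationExistsFace ∧ (toyUniverse₃ d t).Fact_cupExterior ∧
      (toyUniverse₃ d t).Fact_cup_hodge ∧ (toyUniverse₃ d t).Fact_pull_H0 ∧ (toyUniverse₃ d t).Fact_hodge_F0 ∧
      (toyUniverse₃ d t).Fact_cupAlg ∧ (toyUniverse₃ d t).Fact_cupAssoc ∧ (toyUniverse₃ d t).Fact_dimProd ∧
      (toyUniverse₃ d t).Fact_trTopCM :=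
  toyUniverse₃_genericFacts_but_gysin d t hd ht (toyUniverse₃_modelAxioms_all d t)

/-- **Existence: the ten binders of `Assembly.COR_CM_of_descentFactsB₄` together with T-CM are jointly satisfiable**
(witness `toyUniverse₃ 1 4`). -/
theorem exists_descentFactsB₄_inputs_and_trTopCM :
    ∃ U : Universe, (U.ModelAxioms ∧ U.RealisationExistsFace ∧ U.Fact_cupExterior ∧ U.Fact_cup_hodge ∧ U.Fact_cupAlg ∧
      U.Fact_cupAssoc ∧ U.Fact_unitH0 ∧ U.Fact_gysinDescentB ∧ U.Fact_dimProd) ∧ U.Fact_trTopCM :=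
  ⟨toyUniverse₃ 1 4, toyUniverse₃_descentFactsB₄_and_trTopCM_all 1 4 le_rfl (by norm_num)⟩

/-- **Existence: ten of the eleven binders of `Assembly.COR_CM_of_genericFacts` (all but F7 `Fact_gysin`) are jointly
satisfiable** (witness `toyUniverse₃ 1 4`). -/
theorem exists_genericFacts_but_gysin :
    ∃ U : Universe, U.ModelAxioms ∧ U.RealisationExistsFace ∧ U.Fact_cupExterior ∧ U.Fact_cup_hodge ∧ U.Fact_pull_H0 ∧
      U.Fact_hodge_F0 ∧ U.Fact_cupAlg ∧ U.Fact_cupAssoc ∧ U.Fact_dimProd ∧ U.Fact_trTopCM :=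
  ⟨toyUniverse₃ 1 4, toyUniverse₃_genericFacts_but_gysin_all 1 4 le_rfl (by norm_num)⟩

/-- **Two models separating T-CM**: `Fact_trTopCM` HOLDS in `toyUniverse₃ 1 4` (generation 2, Künneth traces) and FAILS in
`HodgeCM.Toy.toyModel` (generation 1, `tr := 0`), both satisfying all 28 model axioms. -/
theorem exists_models_separating_trTopCM :
    (∃ U : Universe, U.ModelAxioms ∧ U.Fact_trTopCM) ∧ (∃ U : Universe, U.ModelAxioms ∧ ¬ U.Fact_trTopCM) :=
  ⟨⟨toyUniverse₃ 1 4, toyUniverse₃_modelAxioms_all 1 4, toyUniverse₃_trTopCM_all 1 4⟩,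
    ⟨toyModel, toyModel_modelAxioms, not_fact_trTopCM exteriorHodgeData⟩⟩

/-- **T-CM `Fact_trTopCM` is independent of the model axioms**: neither `ModelAxioms → Fact_trTopCM` nor
`ModelAxioms → ¬ Fact_trTopCM` holds for all universes. -/
theorem trTopCM_independent :
    (¬ ∀ U : Universe, U.ModelAxioms → U.Fact_trTopCM) ∧ (¬ ∀ U : Universe, U.ModelAxioms → ¬ U.Fact_trTopCM) :=
  ⟨fun h => not_fact_trTopCM exteriorHodgeData (h toyModel toyModel_modelAxioms),
    fun h => h (toyUniverse₃ 1 4) (toyUniverse₃_modelAxioms_all 1 4) (toyUniverse₃_trTopCM_all 1 4)⟩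

end HodgeCM.ToyG2
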